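import Summits.Ventures.YMGap.RobustBall.UniformMassGap
import Summits.Ventures.YMGap.RobustBall.ConcentrationKR
import Summits.Ventures.YMGap.Thresholds.ZdSmoothingLipschitz
import Summits.Ventures.YMGap.Thresholds.CouplingDerivativeTools
import HarnessLib

/-!
# Venture YMGap, track ROBUST-BALL — LIPSCHITZ CYLINDERS FEED THE BOX-SUM CLT: from the cell's clustering currency
# `PerturbedClustering` to the pair clustering bound of `BoxSumCLT.tendstoInDistribution_boxSum`

HONEST FRAMING. WHAT THIS IS: a venture file (cell `pub-ymgap`, track Y2 ROBUST-BALL, seat ds-3, theorems only): the ADAPTER of the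
object «C-CLT». The box-sum CLT asks for a pair clustering bound on `cov_μ(φ(a Σ_{x∈P} F∘θ_x), ψ(a Σ_{y∈Q} F∘θ_y))` for `1`-Lipschitz
`φ, ψ` bounded by `1`; the cell's clustering theorems (`PerturbedClustering d N β W supp m A`: every DLR state of the member clusters on
Lipschitz cylinders with disjoint supports `|Λ₁|, |Λ₂| ≤ n` at rate `m` with constant `A n²`) provide it for every LIPSCHITZ CYLINDER
`F` (support `Δ`, constant `K`):
* `isLipschitzCylinder_comp_sum` — `φ(a Σ_{x∈P} F∘θ_x)` is a Lipschitz cylinder on `⋃_{x∈P} (Δ − x)` with constant `|a| #P K`;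
* `card_suppUnion_le` — that support has `≤ #P #Δ` links; `le_setDistEdges_suppUnion` / `disjoint_suppUnion` — `D`-separated site
  sets give supports at link distance `≥ D − δ` (`δ` = a bound on the base-point spread of `Δ`), disjoint once `D > δ`;
* ★ `pairClustering_of_clustering` (the clustering body at ONE state `μ`; wrappers `pairClustering_of_perturbedClustering[S]` for
  the tier-1 / tier-2 currencies at a DLR state of the member) — for `D ≥ δ + 1`:
  `|cov_μ(φ(a Σ_P F∘θ), ψ(a Σ_Q F∘θ))| ≤ (A #Δ² e^{mδ} max(1, K²)) (#P + #Q)² (1 + a² #P #Q) e^{−m D}`.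
WHAT THIS IS NOT: no new clustering theorem — a change of currency; nothing about the continuum or the Clay problem.
References: the tree's `UniformMassGap.lean` (`PerturbedClustering`), `ConcentrationKR.lean` (`isLipschitzCylinder_comp_configShift`),
`ZdSmoothingLipschitz.lean` (`isLipschitzCylinder_of_dist_le`), `CouplingDerivativeTools.lean` (`dist_restrict_le`).
-/

noncomputable section

open MeasureTheory Filter Function ProbabilityTheory Real
open scoped NNReal
open Literature.Probability.LatticeModels hiding configShift configShift_apply
open Literature.Probability.LatticeModels.DobrushinMetric
open Literature.MathematicalPhysics.QuantumLattice
open Literature.MathematicalPhysics.QuantumFieldTheory hiding ZdEdge Site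
open Summit.Ventures.YMGap.ZdSmoothing Summit.Ventures.YMGap.CouplingResponse

namespace Summit.Ventures.YMGap.RobustBall

namespace BoxSumCLT

variable {d N : ℕ}

/-! ### The composed observable is a Lipschitz cylinder -/

/-- **`φ(a Σ_{x∈P} F∘θ_x)` is a Lipschitz cylinder** on `⋃_{x∈P} {(e.1 − x, e.2) : e ∈ Δ}` with constant `‖a‖ · #P · K`, for a Lipschitz
cylinder `F` (support `Δ`, constant `K`) and a `1`-Lipschitz `φ`. [folklore] -/
theorem isLipschitzCylinder_comp_sum {F : LGConfig d (SUN N) → ℝ} {Δ : Finset (ZdEdge d)} {K : ℝ≥0}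
    (hF : IsLipschitzCylinder (fundamentalRep (Fin N)) F Δ K) (P : Finset (Site d)) (a : ℝ) {φ : ℝ → ℝ} (hφ : LipschitzWith 1 φ) :
    IsLipschitzCylinder (fundamentalRep (Fin N)) (fun U => φ (a * ∑ x ∈ P, F (configShift x U)))
      (P.biUnion fun x => Δ.image fun e => (e.1 - x, e.2)) (‖a‖₊ * P.card * K) := by
  classical
  set S : Finset (ZdEdge d) := P.biUnion fun x => Δ.image fun e => (e.1 - x, e.2) with hS
  refine isLipschitzCylinder_of_dist_le fun U V => ?_
  set δUV := dist (fun e : ↥S => suEntries (U e)) (fun e : ↥S => suEntries (V e)) with hδ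
  -- each translate moves by at most `K · δUV`
  have hterm : ∀ x ∈ P, |F (configShift x U) - F (configShift x V)| ≤ K * δUV := by
    intro x hx
    obtain ⟨g, hg, hFg⟩ := (isLipschitzCylinder_comp_configShift hF x).exists_suEntries
    have hsub : (Δ.image fun e => (e.1 - x, e.2)) ⊆ S := Finset.subset_biUnion_of_mem (fun x => Δ.image fun e => (e.1 - x, e.2)) hx
    have e1 : F (configShift x U) = g fun e : ↥(Δ.image fun e => (e.1 - x, e.2)) => suEntries (U e) := hFg U
    have e2 : F (configShift x V) = g fun e : ↥(Δ.image fun e => (e.1 - x, e.2)) => suEntries (V e) := hFg V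
    rw [e1, e2, ← Real.dist_eq]
    exact (hg.dist_le_mul _ _).trans (mul_le_mul_of_nonneg_left (dist_restrict_le hsub U V) K.2)
  calc |φ (a * ∑ x ∈ P, F (configShift x U)) - φ (a * ∑ x ∈ P, F (configShift x V))|
      ≤ |a * ∑ x ∈ P, F (configShift x U) - a * ∑ x ∈ P, F (configShift x V)| := by
        have h := hφ.dist_le_mul (a * ∑ x ∈ P, F (configShift x U)) (a * ∑ x ∈ P, F (configShift x V))
        rwa [NNReal.coe_one, one_mul, Real.dist_eq, Real.dist_eq] at h
    _ = |a| * |∑ x ∈ P, (F (configShift x U) - F (configShift x V))| := by rw [← mul_sub, abs_mul, Finset.sum_sub_distrib]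
    _ ≤ |a| * ∑ x ∈ P, K * δUV :=
        mul_le_mul_of_nonneg_left ((Finset.abs_sum_le_sum_abs _ _).trans (Finset.sum_le_sum hterm)) (abs_nonneg a)
    _ = (‖a‖₊ * P.card * K : ℝ≥0) * δUV := by
        rw [Finset.sum_const, nsmul_eq_mul]; push_cast; rw [Real.norm_eq_abs]; ring

/-- The support of the composed observable has at most `#P · #Δ` links. [folklore] -/
theorem card_suppUnion_le (P : Finset (Site d)) (Δ : Finset (ZdEdge d)) :
    (P.biUnion fun x => Δ.image fun e => (e.1 - x, e.2)).card ≤ P.card * Δ.card := by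
  classical
  refine (Finset.card_biUnion_le).trans ?_
  rw [← smul_eq_mul, ← Finset.sum_const]
  exact Finset.sum_le_sum fun x _ => Finset.card_image_le

/-- **Separated site sets give separated supports**: if `‖x − y‖ ≥ D` for `x ∈ P`, `y ∈ Q` and the base points of `Δ` are within `δ` of
each other, then any two links of the two supports have base points at distance `≥ D − δ`. [folklore] -/
theorem norm_sub_ge_of_mem_suppUnion {P Q : Finset (Site d)} {Δ : Finset (ZdEdge d)} {D δ : ℝ}
    (hPQ : ∀ x ∈ P, ∀ y ∈ Q, D ≤ ‖x - y‖) (hδ : ∀ e ∈ Δ, ∀ e' ∈ Δ, ‖e.1 - e'.1‖ ≤ δ)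
    {g g' : ZdEdge d} (hg : g ∈ P.biUnion fun x => Δ.image fun e => (e.1 - x, e.2))
    (hg' : g' ∈ Q.biUnion fun x => Δ.image fun e => (e.1 - x, e.2)) : D - δ ≤ ‖g.1 - g'.1‖ := by
  classical
  obtain ⟨x, hx, hgx⟩ := Finset.mem_biUnion.1 hg
  obtain ⟨y, hy, hgy⟩ := Finset.mem_biUnion.1 hg'
  obtain ⟨e, he, rfl⟩ := Finset.mem_image.1 hgx
  obtain ⟨e', he', rfl⟩ := Finset.mem_image.1 hgy
  simp only
  have h1 := hPQ x hx y hy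
  have h2 := hδ e he e' he'
  have hid : (y - x : Site d) = (e.1 - x - (e'.1 - y)) - (e.1 - e'.1) := by abel
  have h3 : ‖y - x‖ ≤ ‖e.1 - x - (e'.1 - y)‖ + ‖e.1 - e'.1‖ := by rw [hid]; exact norm_sub_le _ _
  rw [← norm_neg (y - x), neg_sub] at h3
  linarith

/-- The supports are at `setDistEdges ≥ D − δ` (when both are nonempty). [folklore] -/
theorem le_setDistEdges_suppUnion {P Q : Finset (Site d)} {Δ : Finset (ZdEdge d)} {D δ : ℝ}
    (hPQ : ∀ x ∈ P, ∀ y ∈ Q, D ≤ ‖x - y‖) (hδ : ∀ e ∈ Δ, ∀ e' ∈ Δ, ‖e.1 - e'.1‖ ≤ δ)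
    (hne : ((P.biUnion fun x => Δ.image fun e => (e.1 - x, e.2)) ×ˢ (Q.biUnion fun x => Δ.image fun e => (e.1 - x, e.2))).Nonempty) :
    D - δ ≤ setDistEdges (P.biUnion fun x => Δ.image fun e => (e.1 - x, e.2)) (Q.biUnion fun x => Δ.image fun e => (e.1 - x, e.2)) := by
  unfold setDistEdges
  rw [dif_pos hne]
  refine (Finset.le_inf'_iff hne _).2 fun p hp => ?_
  rw [Finset.mem_product] at hp
  exact norm_sub_ge_of_mem_suppUnion hPQ hδ hp.1 hp.2

/-- Once `D > δ` the supports are disjoint. [folklore] -/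
theorem disjoint_suppUnion {P Q : Finset (Site d)} {Δ : Finset (ZdEdge d)} {D δ : ℝ}
    (hPQ : ∀ x ∈ P, ∀ y ∈ Q, D ≤ ‖x - y‖) (hδ : ∀ e ∈ Δ, ∀ e' ∈ Δ, ‖e.1 - e'.1‖ ≤ δ) (hD : δ < D) :
    Disjoint (P.biUnion fun x => Δ.image fun e => (e.1 - x, e.2)) (Q.biUnion fun x => Δ.image fun e => (e.1 - x, e.2)) := by
  classical
  rw [Finset.disjoint_left]
  intro g hg hg'
  have h := norm_sub_ge_of_mem_suppUnion hPQ hδ hg hg'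
  simp at h
  linarith

/-! ### The adapter -/

/-- A bounded-by-one observable has `√(∫ F² dμ) ≤ 1` on a probability space. [folklore] -/
theorem sqrt_integral_sq_le_one {Ω : Type*} [MeasurableSpace Ω] {μ : Measure Ω} [IsProbabilityMeasure μ] {F : Ω → ℝ}
    (hF : ∀ ω, |F ω| ≤ 1) : Real.sqrt (∫ ω, F ω ^ 2 ∂μ) ≤ 1 := by
  rw [Real.sqrt_le_one]
  have h := integral_mono_of_nonneg (μ := μ) (f := fun ω => F ω ^ 2) (g := fun _ => (1 : ℝ)) (Eventually.of_forall fun ω => sq_nonneg _)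
    (integrable_const _) (Eventually.of_forall fun ω => by
      show F ω ^ 2 ≤ 1
      have := hF ω; rw [← sq_abs]; nlinarith [abs_nonneg (F ω)])
  simpa using h

/-- ★ **THE ADAPTER: clustering on Lipschitz cylinders ⇒ the pair clustering bound of the box-sum CLT.** Let `μ` be a probability
measure on the `SU(N)` link configurations satisfying the BODY of the cell's clustering currency with rate `m ≥ 0` and constant `A n²`
(`A ≥ 0`; e.g. `PerturbedClustering d N β W supp m A` / `PerturbedClusteringS …` at a DLR state of the member), `F` a Lipschitz
cylinder with support `Δ`, constant `K`, base-point spread `≤ δ`. Then for all finite `P, Q ⊆ ℤ^d`, `D ≥ δ + 1`, `a`, and `1`-Lipschitz `φ, ψ`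
bounded by `1` with `‖x − y‖ ≥ D` on `P × Q`:
`|cov_μ(φ(a Σ_{x∈P} F∘θ_x), ψ(a Σ_{y∈Q} F∘θ_y))| ≤ (A #Δ² e^{mδ} max(1, K²)) · (#P + #Q)² · (1 + a² #P #Q) · e^{−m D}`. [folklore] -/
theorem pairClustering_of_clustering {m A : ℝ} {μ : Measure (LGConfig d (SUN N))} [IsProbabilityMeasure μ] (hm : 0 ≤ m) (hA : 0 ≤ A)
    (hclμ : ∀ (n : ℕ) (F₁ F₂ : LGConfig d (SUN N) → ℝ) (Λ₁ Λ₂ : Finset (ZdEdge d)) (K₁ K₂ : ℝ≥0),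
      Λ₁.card ≤ n → Λ₂.card ≤ n → Disjoint Λ₁ Λ₂ →
      IsLipschitzCylinder (fundamentalRep (Fin N)) F₁ Λ₁ K₁ → IsLipschitzCylinder (fundamentalRep (Fin N)) F₂ Λ₂ K₂ →
        |cov[F₁, F₂; μ]| ≤ A * (n : ℝ) ^ 2 * Real.exp (-m * setDistEdges Λ₁ Λ₂) *
          ((K₁ : ℝ) * K₂ + Real.sqrt (∫ U, F₁ U ^ 2 ∂μ) * Real.sqrt (∫ U, F₂ U ^ 2 ∂μ)))
    {F : LGConfig d (SUN N) → ℝ} {Δ : Finset (ZdEdge d)} {K : ℝ≥0} (hF : IsLipschitzCylinder (fundamentalRep (Fin N)) F Δ K)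
    {δ : ℝ} (hδ : ∀ e ∈ Δ, ∀ e' ∈ Δ, ‖e.1 - e'.1‖ ≤ δ) :
    ∀ (P Q : Finset (Site d)) (D a : ℝ) (φ ψ : ℝ → ℝ), δ + 1 ≤ D → (∀ x ∈ P, ∀ y ∈ Q, D ≤ ‖x - y‖) →
      LipschitzWith 1 φ → LipschitzWith 1 ψ → (∀ z, |φ z| ≤ 1) → (∀ z, |ψ z| ≤ 1) →
      |cov[fun U => φ (a * ∑ x ∈ P, F (configShift x U)), fun U => ψ (a * ∑ y ∈ Q, F (configShift y U)); μ]| ≤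
        (A * (Δ.card : ℝ) ^ 2 * Real.exp (m * δ) * max 1 ((K : ℝ) ^ 2)) * ((P.card : ℝ) + Q.card) ^ 2 *
          (1 + a ^ 2 * P.card * Q.card) * Real.exp (-m * D) := by
  classical
  intro P Q D a φ ψ hD hPQ hφ hψ hφb hψb
  set ΛP := P.biUnion fun x => Δ.image fun e => (e.1 - x, e.2) with hΛP
  set ΛQ := Q.biUnion fun x => Δ.image fun e => (e.1 - x, e.2) with hΛQ
  set F₁ : LGConfig d (SUN N) → ℝ := fun U => φ (a * ∑ x ∈ P, F (configShift x U)) with hF₁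
  set F₂ : LGConfig d (SUN N) → ℝ := fun U => ψ (a * ∑ y ∈ Q, F (configShift y U)) with hF₂
  have hRHS0 : 0 ≤ (A * (Δ.card : ℝ) ^ 2 * Real.exp (m * δ) * max 1 ((K : ℝ) ^ 2)) * ((P.card : ℝ) + Q.card) ^ 2 *
      (1 + a ^ 2 * P.card * Q.card) * Real.exp (-m * D) := by
    have : (0 : ℝ) ≤ 1 + a ^ 2 * P.card * Q.card :=
      add_nonneg zero_le_one (mul_nonneg (mul_nonneg (sq_nonneg a) (Nat.cast_nonneg _)) (Nat.cast_nonneg _))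
    have : (0 : ℝ) ≤ max 1 ((K : ℝ) ^ 2) := le_max_of_le_left zero_le_one
    positivity
  -- degenerate case: one support empty ⇒ that observable is constant ⇒ covariance zero
  by_cases hne : (ΛP ×ˢ ΛQ).Nonempty
  swap
  · rw [Finset.not_nonempty_iff_eq_empty, Finset.product_eq_empty] at hne
    have hconst : ∀ {R : Finset (Site d)} {χ : ℝ → ℝ}, (R.biUnion fun x => Δ.image fun e => (e.1 - x, e.2)) = ∅ →
        ∃ c, (fun U => χ (a * ∑ x ∈ R, F (configShift x U))) = fun _ => c := by
      intro R χ hR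
      by_cases hR0 : R = ∅
      · exact ⟨χ (a * 0), by funext U; simp [hR0]⟩
      · obtain ⟨x, hx⟩ := Finset.nonempty_iff_ne_empty.2 hR0
        have hΔ : Δ = ∅ := by
          have hsub := Finset.subset_biUnion_of_mem (fun x => Δ.image fun e => (e.1 - x, e.2)) hx
          rw [hR, Finset.subset_empty, Finset.image_eq_empty] at hsub
          exact hsub
        obtain ⟨f, -, hFf⟩ := hF
        refine ⟨χ (a * ∑ x ∈ R, f fun e i j => (fundamentalRep (Fin N)) ((1 : LGConfig d (SUN N)) e) i j), funext fun U => ?_⟩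
        congr 2
        refine Finset.sum_congr rfl fun y _ => ?_
        rw [hFf]
        congr 1
        funext e
        exact (Finset.eq_empty_iff_forall_notMem.1 hΔ _ e.2).elim
    rcases hne with h | h
    · obtain ⟨c, hc⟩ := hconst (χ := φ) h
      rw [show F₁ = fun _ => c from hc, covariance_const_left, abs_zero]
      exact hRHS0
    · obtain ⟨c, hc⟩ := hconst (χ := ψ) h
      rw [show F₂ = fun _ => c from hc, covariance_const_right, abs_zero]
      exact hRHS0
  -- main case
  have hδD : δ < D := by linarith
  set n : ℕ := (P.card + Q.card) * Δ.card with hn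
  have h1 : ΛP.card ≤ n := (card_suppUnion_le P Δ).trans (Nat.mul_le_mul_right _ (Nat.le_add_right _ _))
  have h2 : ΛQ.card ≤ n := (card_suppUnion_le Q Δ).trans (Nat.mul_le_mul_right _ (Nat.le_add_left _ _))
  have hdisj : Disjoint ΛP ΛQ := disjoint_suppUnion hPQ hδ hδD
  have hL1 : IsLipschitzCylinder (fundamentalRep (Fin N)) F₁ ΛP (‖a‖₊ * P.card * K) := isLipschitzCylinder_comp_sum hF P a hφ
  have hL2 : IsLipschitzCylinder (fundamentalRep (Fin N)) F₂ ΛQ (‖a‖₊ * Q.card * K) := isLipschitzCylinder_comp_sum hF Q a hψ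
  have h := hclμ n F₁ F₂ ΛP ΛQ _ _ h1 h2 hdisj hL1 hL2
  have hdist : D - δ ≤ setDistEdges ΛP ΛQ := le_setDistEdges_suppUnion hPQ hδ hne
  have hsq1 : Real.sqrt (∫ U, F₁ U ^ 2 ∂μ) ≤ 1 := sqrt_integral_sq_le_one fun U => hφb _
  have hsq2 : Real.sqrt (∫ U, F₂ U ^ 2 ∂μ) ≤ 1 := sqrt_integral_sq_le_one fun U => hψb _
  refine h.trans ?_
  -- compare the two right-hand sides factor by factor
  have hn2 : ((n : ℕ) : ℝ) ^ 2 = ((P.card : ℝ) + Q.card) ^ 2 * (Δ.card : ℝ) ^ 2 := by rw [hn]; push_cast; ring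
  have hexp : Real.exp (-m * setDistEdges ΛP ΛQ) ≤ Real.exp (m * δ) * Real.exp (-m * D) := by
    rw [← Real.exp_add]; exact Real.exp_le_exp.2 (by nlinarith)
  have hK : ((‖a‖₊ * P.card * K : ℝ≥0) : ℝ) * ((‖a‖₊ * Q.card * K : ℝ≥0) : ℝ) = a ^ 2 * P.card * Q.card * (K : ℝ) ^ 2 := by
    push_cast; rw [Real.norm_eq_abs,
      show |a| * (P.card : ℝ) * (K : ℝ) * (|a| * (Q.card : ℝ) * (K : ℝ)) = |a| ^ 2 * ((P.card : ℝ) * Q.card * (K : ℝ) ^ 2) by ring,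
      sq_abs]; ring
  have hlast : ((‖a‖₊ * P.card * K : ℝ≥0) : ℝ) * ((‖a‖₊ * Q.card * K : ℝ≥0) : ℝ) +
      Real.sqrt (∫ U, F₁ U ^ 2 ∂μ) * Real.sqrt (∫ U, F₂ U ^ 2 ∂μ) ≤ max 1 ((K : ℝ) ^ 2) * (1 + a ^ 2 * P.card * Q.card) := by
    rw [hK]
    have hs : Real.sqrt (∫ U, F₁ U ^ 2 ∂μ) * Real.sqrt (∫ U, F₂ U ^ 2 ∂μ) ≤ 1 :=
      (mul_le_mul hsq1 hsq2 (Real.sqrt_nonneg _) zero_le_one).trans (by norm_num)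
    have hk1 : (K : ℝ) ^ 2 ≤ max 1 ((K : ℝ) ^ 2) := le_max_right _ _
    have hk2 : (1 : ℝ) ≤ max 1 ((K : ℝ) ^ 2) := le_max_left _ _
    have hpq : (0 : ℝ) ≤ a ^ 2 * P.card * Q.card := mul_nonneg (mul_nonneg (sq_nonneg a) (Nat.cast_nonneg _)) (Nat.cast_nonneg _)
    nlinarith
  have hA0 : 0 ≤ A * ((n : ℕ) : ℝ) ^ 2 := by positivity
  calc A * ((n : ℕ) : ℝ) ^ 2 * Real.exp (-m * setDistEdges ΛP ΛQ) *
        (((‖a‖₊ * P.card * K : ℝ≥0) : ℝ) * ((‖a‖₊ * Q.card * K : ℝ≥0) : ℝ) +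
          Real.sqrt (∫ U, F₁ U ^ 2 ∂μ) * Real.sqrt (∫ U, F₂ U ^ 2 ∂μ))
      ≤ A * ((n : ℕ) : ℝ) ^ 2 * (Real.exp (m * δ) * Real.exp (-m * D)) * (max 1 ((K : ℝ) ^ 2) * (1 + a ^ 2 * P.card * Q.card)) :=
        mul_le_mul (mul_le_mul_of_nonneg_left hexp hA0) hlast (by positivity) (by positivity)
    _ = (A * (Δ.card : ℝ) ^ 2 * Real.exp (m * δ) * max 1 ((K : ℝ) ^ 2)) * ((P.card : ℝ) + Q.card) ^ 2 *
          (1 + a ^ 2 * P.card * Q.card) * Real.exp (-m * D) := by rw [hn2]; ring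

/-- **Tier-1 wrapper**: `PerturbedClustering d N β W supp m A` and a DLR state `μ` of the member give the pair clustering bound for
every Lipschitz cylinder. [folklore] -/
theorem pairClustering_of_perturbedClustering {β m A : ℝ} {W : Potential (ZdEdge d) (SUN N)}
    {supp : Finset (ZdEdge d) → Finset (Finset (ZdEdge d))} (hcl : PerturbedClustering d N β W supp m A) (hm : 0 ≤ m) (hA : 0 ≤ A)
    {μ : Measure (LGConfig d (SUN N))} [IsProbabilityMeasure μ]
    (hμ : μ ∈ perturbedGibbsMeasures (d := d) (fundamentalRep (Fin N)) (N * β) W supp)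
    {F : LGConfig d (SUN N) → ℝ} {Δ : Finset (ZdEdge d)} {K : ℝ≥0} (hF : IsLipschitzCylinder (fundamentalRep (Fin N)) F Δ K)
    {δ : ℝ} (hδ : ∀ e ∈ Δ, ∀ e' ∈ Δ, ‖e.1 - e'.1‖ ≤ δ) :
    ∀ (P Q : Finset (Site d)) (D a : ℝ) (φ ψ : ℝ → ℝ), δ + 1 ≤ D → (∀ x ∈ P, ∀ y ∈ Q, D ≤ ‖x - y‖) →
      LipschitzWith 1 φ → LipschitzWith 1 ψ → (∀ z, |φ z| ≤ 1) → (∀ z, |ψ z| ≤ 1) →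
      |cov[fun U => φ (a * ∑ x ∈ P, F (configShift x U)), fun U => ψ (a * ∑ y ∈ Q, F (configShift y U)); μ]| ≤
        (A * (Δ.card : ℝ) ^ 2 * Real.exp (m * δ) * max 1 ((K : ℝ) ^ 2)) * ((P.card : ℝ) + Q.card) ^ 2 *
          (1 + a ^ 2 * P.card * Q.card) * Real.exp (-m * D) :=
  pairClustering_of_clustering hm hA (hcl μ hμ) hF hδ

/-- **Tier-2 wrapper**: `PerturbedClusteringS d N β W m A` and a DLR state `μ` of the summable member. [folklore] -/
theorem pairClustering_of_perturbedClusteringS {β m A : ℝ} {W : Potential (ZdEdge d) (SUN N)}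
    (hcl : PerturbedClusteringS d N β W m A) (hm : 0 ≤ m) (hA : 0 ≤ A)
    {μ : Measure (LGConfig d (SUN N))} [IsProbabilityMeasure μ]
    (hμ : μ ∈ perturbedGibbsMeasuresS (d := d) (fundamentalRep (Fin N)) (N * β) W)
    {F : LGConfig d (SUN N) → ℝ} {Δ : Finset (ZdEdge d)} {K : ℝ≥0} (hF : IsLipschitzCylinder (fundamentalRep (Fin N)) F Δ K)
    {δ : ℝ} (hδ : ∀ e ∈ Δ, ∀ e' ∈ Δ, ‖e.1 - e'.1‖ ≤ δ) :
    ∀ (P Q : Finset (Site d)) (D a : ℝ) (φ ψ : ℝ → ℝ), δ + 1 ≤ D → (∀ x ∈ P, ∀ y ∈ Q, D ≤ ‖x - y‖) →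
      LipschitzWith 1 φ → LipschitzWith 1 ψ → (∀ z, |φ z| ≤ 1) → (∀ z, |ψ z| ≤ 1) →
      |cov[fun U => φ (a * ∑ x ∈ P, F (configShift x U)), fun U => ψ (a * ∑ y ∈ Q, F (configShift y U)); μ]| ≤
        (A * (Δ.card : ℝ) ^ 2 * Real.exp (m * δ) * max 1 ((K : ℝ) ^ 2)) * ((P.card : ℝ) + Q.card) ^ 2 *
          (1 + a ^ 2 * P.card * Q.card) * Real.exp (-m * D) :=
  pairClustering_of_clustering hm hA (hcl μ hμ) hF hδ

end BoxSumCLT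

end Summit.Ventures.YMGap.RobustBall

end
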